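import Literature.Algebra.Module.FibreRankSemicontinuity
import Mathlib.LinearAlgebra.Dimension.Finrank
import Mathlib.LinearAlgebra.FiniteDimensional.Lemmas
import HarnessLib

/-!
# The canonical base-change map `B ⊗_A ker d → ker(d ⊗_A B)` of a two-term complex is an isomorphism when
# `coker d` is projective (Mumford, *Abelian Varieties*, §5 Cor. 2; EGA III 7.8.4; Hartshorne III, Prop. 12.11)

Topic `Algebra/Module`; namespace `Literature.Algebra.Module`; a *proofs* file (theorems only; Mathlib +
★ `Algebra/Module/FibreRankSemicontinuity`). Companion of ★ `Algebra/Module/TwoTermComplexBaseChange`, which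
gives SOME `B`-linear isomorphism `B ⊗_A ker d ≅ ker(d ⊗_A B)` from projectivity of the representing module
`Q = (K⁰)^∨ ⧸ im d^∨`. Here the isomorphism is the CANONICAL map — the base change `(ker d ↪ K⁰) ⊗ B` — and the
hypothesis is put on the COKERNEL: for `d : K⁰ → K¹` with `K¹` projective and `coker d = K¹ ⧸ im d` projective,

* `range_baseChange_kerSubtype_eq_ker` — `im((ker d ↪ K⁰) ⊗ B) = ker(d ⊗ B)`, and
  `baseChange_kerSubtype_injective` — `(ker d ↪ K⁰) ⊗ B` is injective, for EVERY `A`-algebra `B`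
  (`im d` is a direct summand of `K¹`, hence projective, hence `ker d` is a direct summand of `K⁰`; split short
  exact sequences stay exact under `− ⊗_A B`; right exactness `lTensor_exact` for the other inclusion);
  packaged as `exists_kerBaseChangeEquiv_canonical` (Mumford §5 Cor. 2 «⇐» / EGA III 7.8.4 (d) ⇒ (a), no
  finiteness, no reducedness);
* `finrank_tensor_coker_add_finrank_range_baseChange` — for an `A`-algebra field `κ`:
  `dim_κ (κ ⊗_A coker d) + rk(d ⊗ κ) = dim_κ (κ ⊗_A K¹)` (right exactness), so with rank–nullity
  `dim_κ (κ ⊗ coker d) = dim (κ ⊗ K¹) − dim (κ ⊗ K⁰) + dim ker(d ⊗ κ)`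
  (`finrank_tensor_coker_eq_of_finrank_eq`);
* `projective_coker_of_finrank_tensor_coker_eq` / **`exists_kerBaseChangeEquiv_canonical_of_finrank_eq`** —
  over a noetherian DOMAIN, if the fibre ranks of `K⁰`, `K¹` and `h⁰(𝔭) = dim ker(d ⊗ κ(𝔭))` are constant on
  `Spec A` then `coker d` is projective (★ `projective_of_finrank_residueField_tensor_eq`) and the canonical
  base-change map is an isomorphism for every `B` (Mumford §5 Cor. 2 in degree `0`; Hartshorne III Cor. 12.9).

Everything is proved; no named facts; no definitions. Mathlib searched and used (pin):
`Module.projective_lifting_property`, `Module.Projective.of_split`, `lTensor_exact`,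
`LinearMap.exact_subtype_ker_map`, `LinearMap.baseChange_comp`, `LinearMap.quotKerEquivOfSurjective`,
`Submodule.finrank_quotient_add_finrank`, `LinearMap.finrank_range_add_finrank_ker`.
Cell `hodgecm-mathlib`, SOCKETS-F §3 node N-bc, leaf (D); count-neutral; B-p10 (g9).

## References

* D. Mumford, *Abelian Varieties*, TIFR Studies in Mathematics 5 (1970), §5 Cor. 2 (p. 50). [MumfordAV1970]
* R. Hartshorne, *Algebraic Geometry*, GTM 52 (1977), III Cor. 12.9, Prop. 12.11. [Hartshorne1977]
* A. Grothendieck, EGA III₂ (1963), 7.8.4.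
-/

universe u

open TensorProduct Module

noncomputable section

namespace Literature.Algebra.Module

/-! ### §1 Split sequences: the canonical base change of `ker d` -/

section Canonical

variable {A : Type u} [CommRing A] {K0 K1 : Type u} [AddCommGroup K0] [Module A K0]
  [AddCommGroup K1] [Module A K1]

/-- If `coker d = K¹ ⧸ im d` is projective, `im d ↪ K¹` has a retraction. [folklore]
[cite: MumfordAV1970, §5 Cor. 2 (p. 50)] -/
theorem exists_retraction_range_of_projective_coker (d : K0 →ₗ[A] K1)
    [Projective A (K1 ⧸ LinearMap.range d)] :
    ∃ r : K1 →ₗ[A] LinearMap.range d, r ∘ₗ (LinearMap.range d).subtype = LinearMap.id := by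
  obtain ⟨s, hs⟩ := Module.projective_lifting_property (LinearMap.range d).mkQ LinearMap.id
    (Submodule.mkQ_surjective _)
  have hmem : ∀ y : K1, y - s ((LinearMap.range d).mkQ y) ∈ LinearMap.range d := by
    intro y
    rw [← Submodule.Quotient.mk_eq_zero, ← Submodule.mkQ_apply, map_sub, ← LinearMap.comp_apply, hs,
      LinearMap.id_apply, sub_self]
  refine ⟨LinearMap.codRestrict _ (LinearMap.id - s ∘ₗ (LinearMap.range d).mkQ) fun y => hmem y, ?_⟩
  apply LinearMap.ext
  intro y
  apply Subtype.ext
  change (y : K1) - s ((LinearMap.range d).mkQ y) = y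
  rw [Submodule.mkQ_apply, (Submodule.Quotient.mk_eq_zero _).2 y.2, map_zero, sub_zero]

/-- If `coker d` and `K¹` are projective, `ker d ↪ K⁰` has a retraction (`im d` is a summand of `K¹`, hence
projective, so `K⁰ ↠ im d` splits). [folklore] [cite: MumfordAV1970, §5 Cor. 2 (p. 50)] -/
theorem exists_retraction_ker_of_projective_coker (d : K0 →ₗ[A] K1) [Projective A K1]
    [Projective A (K1 ⧸ LinearMap.range d)] :
    ∃ r : K0 →ₗ[A] LinearMap.ker d, r ∘ₗ (LinearMap.ker d).subtype = LinearMap.id := by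
  obtain ⟨r₁, hr₁⟩ := exists_retraction_range_of_projective_coker d
  haveI : Projective A (LinearMap.range d) := Projective.of_split _ _ hr₁
  obtain ⟨s, hs⟩ := Module.projective_lifting_property d.rangeRestrict LinearMap.id
    (LinearMap.surjective_rangeRestrict d)
  have hmem : ∀ x : K0, x - s (d.rangeRestrict x) ∈ LinearMap.ker d := by
    intro x
    rw [← LinearMap.ker_rangeRestrict, LinearMap.mem_ker, map_sub, ← LinearMap.comp_apply, hs,
      LinearMap.id_apply, sub_self]
  refine ⟨LinearMap.codRestrict _ (LinearMap.id - s ∘ₗ d.rangeRestrict) fun x => hmem x, ?_⟩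
  apply LinearMap.ext
  intro x
  apply Subtype.ext
  change (x : K0) - s (d.rangeRestrict x) = x
  have hx : d.rangeRestrict (x : K0) = 0 := by
    rw [← LinearMap.mem_ker, LinearMap.ker_rangeRestrict]; exact x.2
  rw [hx, map_zero, sub_zero]

/-- A linear map with a retraction stays injective after any base change. [folklore]
[cite: MumfordAV1970, §5 Cor. 2 (p. 50)] -/
theorem baseChange_injective_of_retraction {M N : Type u} [AddCommGroup M] [Module A M] [AddCommGroup N]
    [Module A N] (i : M →ₗ[A] N) (r : N →ₗ[A] M) (h : r ∘ₗ i = LinearMap.id)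
    (B : Type u) [CommRing B] [Algebra A B] : Function.Injective (i.baseChange B) := by
  have hcomp : (r.baseChange B) ∘ₗ (i.baseChange B) = LinearMap.id := by
    rw [← LinearMap.baseChange_comp, h, LinearMap.baseChange_id]
  exact Function.LeftInverse.injective (g := r.baseChange B) fun x => by
    rw [← LinearMap.comp_apply, hcomp, LinearMap.id_apply]

/-- **`(ker d ↪ K⁰) ⊗ B` is injective** when `K¹` and `coker d` are projective. [cite: MumfordAV1970, §5 Cor. 2 (p. 50)] -/
theorem baseChange_kerSubtype_injective (d : K0 →ₗ[A] K1) [Projective A K1]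
    [Projective A (K1 ⧸ LinearMap.range d)] (B : Type u) [CommRing B] [Algebra A B] :
    Function.Injective ((LinearMap.ker d).subtype.baseChange B) := by
  obtain ⟨r, hr⟩ := exists_retraction_ker_of_projective_coker d
  exact baseChange_injective_of_retraction _ r hr B

/-- **`im((ker d ↪ K⁰) ⊗ B) = ker(d ⊗ B)`** when `coker d` is projective: `(im d ↪ K¹) ⊗ B` is injective (it
has a retraction), and `ker d ↪ K⁰ ↠ im d` stays exact under `− ⊗ B` (right exactness).
[cite: MumfordAV1970, §5 Cor. 2 (p. 50)] [cite: Hartshorne1977, III Prop. 12.11] -/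
theorem range_baseChange_kerSubtype_eq_ker (d : K0 →ₗ[A] K1) [Projective A (K1 ⧸ LinearMap.range d)]
    (B : Type u) [CommRing B] [Algebra A B] :
    LinearMap.range ((LinearMap.ker d).subtype.baseChange B) = LinearMap.ker (d.baseChange B) := by
  obtain ⟨r₁, hr₁⟩ := exists_retraction_range_of_projective_coker d
  have hinj := baseChange_injective_of_retraction _ r₁ hr₁ B
  -- `d = ι ∘ d'` with `d'` surjective onto `im d`
  have hd : d = (LinearMap.range d).subtype ∘ₗ d.rangeRestrict := LinearMap.ext fun _ => rfl
  have hker : LinearMap.ker (d.baseChange B) = LinearMap.ker (d.rangeRestrict.baseChange B) := by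
    conv_lhs => rw [hd, LinearMap.baseChange_comp]
    exact LinearMap.ker_comp_of_ker_eq_bot _ (LinearMap.ker_eq_bot.2 hinj)
  -- right exactness for `ker d' = ker d ↪ K⁰ ↠ im d`
  have hex := lTensor_exact B (LinearMap.exact_subtype_ker_map d.rangeRestrict)
    (LinearMap.surjective_rangeRestrict d)
  rw [hker]
  apply Submodule.ext
  intro x
  rw [LinearMap.mem_ker, LinearMap.mem_range]
  have hx := hex x
  rw [LinearMap.ker_rangeRestrict] at hx
  change (LinearMap.lTensor B d.rangeRestrict x = 0 ↔ x ∈ Set.range (LinearMap.lTensor B (LinearMap.ker d).subtype))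
    at hx
  rw [← LinearMap.baseChange_eq_ltensor, ← LinearMap.baseChange_eq_ltensor] at hx
  rw [hx, Set.mem_range]

/-- **Cohomology and base change in degree `0`, canonical form** (Mumford, *Abelian Varieties*, §5 Cor. 2
«⇐»; EGA III 7.8.4): if `K¹` and `coker d` are projective then for every `A`-algebra `B` the canonical map
`B ⊗_A ker d → ker(d ⊗_A B)`, `b ⊗ x ↦ b ⊗ x`, is a `B`-linear ISOMORPHISM. [cite: MumfordAV1970, §5 Cor. 2 (p. 50)]
[cite: Hartshorne1977, III Prop. 12.11] -/
theorem exists_kerBaseChangeEquiv_canonical (d : K0 →ₗ[A] K1) [Projective A K1]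
    [Projective A (K1 ⧸ LinearMap.range d)] (B : Type u) [CommRing B] [Algebra A B] :
    ∃ e : B ⊗[A] LinearMap.ker d ≃ₗ[B] LinearMap.ker (d.baseChange B),
      ∀ x, ((e x : LinearMap.ker (d.baseChange B)) : B ⊗[A] K0) = (LinearMap.ker d).subtype.baseChange B x := by
  have hrange := range_baseChange_kerSubtype_eq_ker d B
  have hmem : ∀ x, (LinearMap.ker d).subtype.baseChange B x ∈ LinearMap.ker (d.baseChange B) := fun x => by
    rw [← hrange]; exact LinearMap.mem_range_self _ x
  refine ⟨LinearEquiv.ofBijective (LinearMap.codRestrict _ ((LinearMap.ker d).subtype.baseChange B) hmem)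
    ⟨fun x y hxy => baseChange_kerSubtype_injective d B (congrArg Subtype.val hxy), fun y => ?_⟩, fun x => rfl⟩
  have hy : (y : B ⊗[A] K0) ∈ LinearMap.range ((LinearMap.ker d).subtype.baseChange B) := by
    rw [hrange]; exact y.2
  obtain ⟨x, hx⟩ := hy
  exact ⟨x, Subtype.ext hx⟩

end Canonical

/-! ### §2 Fibre ranks of the cokernel; projectivity of `coker d` from constancy -/

section Coker

variable {A : Type u} [CommRing A] {K0 K1 : Type u} [AddCommGroup K0] [Module A K0]
  [AddCommGroup K1] [Module A K1]

/-- **`dim_κ (κ ⊗_A coker d) + rk(d ⊗ κ) = dim_κ (κ ⊗_A K¹)`** for an `A`-algebra field `κ` and `K¹` finite: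
`κ ⊗ coker d = coker(d ⊗ κ)` by right exactness. [folklore] [cite: MumfordAV1970, §5 Cor. 2 (p. 50)] -/
theorem finrank_tensor_coker_add_finrank_range_baseChange (d : K0 →ₗ[A] K1) [Module.Finite A K1]
    (κ : Type u) [Field κ] [Algebra A κ] :
    finrank κ (κ ⊗[A] (K1 ⧸ LinearMap.range d)) + finrank κ (LinearMap.range (d.baseChange κ)) =
      finrank κ (κ ⊗[A] K1) := by
  -- `φ = mkQ ⊗ κ : κ ⊗ K¹ → κ ⊗ coker d` is surjective with kernel `im(d ⊗ κ)`
  set φ := (LinearMap.range d).mkQ.baseChange κ with hφ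
  have hsurj : Function.Surjective φ := by
    rw [hφ, LinearMap.baseChange_eq_ltensor]
    exact LinearMap.lTensor_surjective κ (Submodule.mkQ_surjective _)
  have hex := lTensor_exact κ (LinearMap.exact_map_mkQ_range d) (Submodule.mkQ_surjective _)
  have hker : LinearMap.ker φ = LinearMap.range (d.baseChange κ) := by
    apply Submodule.ext
    intro x
    rw [LinearMap.mem_ker, LinearMap.mem_range]
    have hx := hex x
    change (LinearMap.lTensor κ (LinearMap.range d).mkQ x = 0 ↔ x ∈ Set.range (LinearMap.lTensor κ d)) at hx
    rw [← LinearMap.baseChange_eq_ltensor, ← LinearMap.baseChange_eq_ltensor] at hx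
    rw [hx, Set.mem_range]
  rw [← (LinearMap.quotKerEquivOfSurjective φ hsurj).finrank_eq, ← hker]
  exact Submodule.finrank_quotient_add_finrank (LinearMap.ker φ)

/-- Rank–nullity form: `dim_κ (κ ⊗_A coker d) + dim_κ (κ ⊗_A K⁰) = dim_κ (κ ⊗_A K¹) + dim_κ ker(d ⊗ κ)`.
[folklore] [cite: MumfordAV1970, §5 Cor. 2 (p. 50)] -/
theorem finrank_tensor_coker_add_eq (d : K0 →ₗ[A] K1) [Module.Finite A K0] [Module.Finite A K1]
    (κ : Type u) [Field κ] [Algebra A κ] :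
    finrank κ (κ ⊗[A] (K1 ⧸ LinearMap.range d)) + finrank κ (κ ⊗[A] K0) =
      finrank κ (κ ⊗[A] K1) + finrank κ (LinearMap.ker (d.baseChange κ)) := by
  rw [← finrank_tensor_coker_add_finrank_range_baseChange d κ,
    ← LinearMap.finrank_range_add_finrank_ker (d.baseChange κ)]
  ring

/-- **`coker d` is projective when its fibre rank is constant over a noetherian domain**
(★ `projective_of_finrank_residueField_tensor_eq`). [cite: MumfordAV1970, §5 Cor. 2 (p. 50)]
[cite: Hartshorne1977, II Ex. 5.8 (c)] -/
theorem projective_coker_of_finrank_tensor_coker_eq [IsDomain A] [IsNoetherianRing A] (d : K0 →ₗ[A] K1)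
    [Module.Finite A K1] (c : ℕ) (h : ∀ p : PrimeSpectrum A,
      finrank p.asIdeal.ResidueField (p.asIdeal.ResidueField ⊗[A] (K1 ⧸ LinearMap.range d)) = c) :
    Projective A (K1 ⧸ LinearMap.range d) :=
  projective_of_finrank_residueField_tensor_eq _ c h

/-- **Mumford, *Abelian Varieties*, §5 Cor. 2 in degree `0`, canonical form**: over a noetherian domain, if
the fibre ranks of `K⁰` and `K¹` are constant (`n₀`, `n₁`; automatic for finite projectives over a domain) and
`h⁰(𝔭) = dim_{κ(𝔭)} ker(d ⊗ κ(𝔭))` is constant (`r`, with `n₀ ≤ n₁ + r`), then `coker d` is projective and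
the canonical map `B ⊗_A ker d → ker(d ⊗_A B)` is an isomorphism for EVERY `A`-algebra `B`.
[cite: MumfordAV1970, §5 Cor. 2 (p. 50)] [cite: Hartshorne1977, III Cor. 12.9] -/
theorem exists_kerBaseChangeEquiv_canonical_of_finrank_eq [IsDomain A] [IsNoetherianRing A]
    (d : K0 →ₗ[A] K1) [Module.Finite A K0] [Module.Finite A K1] [Projective A K1] (n₀ n₁ r : ℕ)
    (h₀ : ∀ p : PrimeSpectrum A, finrank p.asIdeal.ResidueField (p.asIdeal.ResidueField ⊗[A] K0) = n₀)
    (h₁ : ∀ p : PrimeSpectrum A, finrank p.asIdeal.ResidueField (p.asIdeal.ResidueField ⊗[A] K1) = n₁)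
    (hr : ∀ p : PrimeSpectrum A,
      finrank p.asIdeal.ResidueField (LinearMap.ker (d.baseChange p.asIdeal.ResidueField)) = r)
    (B : Type u) [CommRing B] [Algebra A B] :
    Projective A (K1 ⧸ LinearMap.range d) ∧
    ∃ e : B ⊗[A] LinearMap.ker d ≃ₗ[B] LinearMap.ker (d.baseChange B),
      ∀ x, ((e x : LinearMap.ker (d.baseChange B)) : B ⊗[A] K0) = (LinearMap.ker d).subtype.baseChange B x := by
  have hc : ∀ p : PrimeSpectrum A,
      finrank p.asIdeal.ResidueField (p.asIdeal.ResidueField ⊗[A] (K1 ⧸ LinearMap.range d)) = n₁ + r - n₀ := by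
    intro p
    have := finrank_tensor_coker_add_eq d p.asIdeal.ResidueField
    rw [h₀ p, h₁ p, hr p] at this
    omega
  haveI := projective_coker_of_finrank_tensor_coker_eq d (n₁ + r - n₀) hc
  exact ⟨this, exists_kerBaseChangeEquiv_canonical d B⟩

end Coker

end Literature.Algebra.Module

end
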